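import Summits.QuantumFields.BalabanUV.Beta.FP.KernelPeriodisationFibTrace

/-!
# `BalabanUV.Beta.FP.TorusTwoScaleSandwichPeriodic` — road «FP» for binder row D1, ROUTE T (β1), J-RISK-3′ «THE PACKING AT THE PASS», THE ENGINE:
# **A TWO-SCALE SANDWICH OF LATTICE KERNELS, PERIODISED ON THE FINE TORUS, IS THE SANDWICH OF THE PERIODISED CORE BY THE PERIODISED LEGS**

WHY.  The END wrapper `StepRecursionFeedNestedNamedB` (p405971 ✓) displays the first-order jet at the total slot as leaf-05's
`HL + compSumSym Lc (onTowerFamily Lc M F) M lev rs (n+1)` — per storey `k` a companion `G_k` ON THE STOREY TORUS `T_k` conjugated by the composite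
averaging rows `(compRowsSym …)ᵀ · G_k · compRowsSym …` from the finest torus `T_N` (leaf-06 `TorusCompositeCompanionSumG.compSumG_succ`); the N-binding
`hHN₁` reads the same jet as ONE periodised lattice kernel `perF T_N (dper T_N 𝒱)`, and an2's F6a′ `CompositeVertexKernelUnroll.compVHKer_unroll` unrolls
the lattice composite vertex kernel into ONE SANDWICH PER STOREY: a brick core between two composite linear legs (`storeyVH`), lifted to the top slot
(`liftUp`).  The identity turning a periodised lattice sandwich into a torus sandwich of periodised objects is the road's «packing at the pass» (R-FP-75;
an2 W-4 l.66570 (2)(ii); `g35/SPEC-47.md` §C (1); `g36/SPEC-48.md`).  THIS FILE IS ITS ENGINE, carrier-free and kernel-generic (nothing of an2's bricks, leaf-06's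
rows or the wrapper is named); the instantiation (legs := the periodised composite sym rows, core := the storey's Λ-brick) is the next file.

WHAT ([folklore] finite-sum ∕ `tsum` bookkeeping over OUR periodisation objects `perZ ∕ perF ∕ dper ∕ pbox ∕ translate`; two period vectors
`Tc` (the storey torus, coarse) and `Tf` (the finest torus), NO divisibility assumed — the identity is formal in the pair):
* §1 scalar engines on `ℤ^{d+1}`: `sum_mul_biperiodic_mul_eq_box` (lattice = box × period lattice, in both variables, against a bi-`Tc`-periodic
  pairing: `Σ_{γ γ′} f γ · P γ γ′ · g γ′ = Σ_{α α′ ∈ pbox Tc} f^per α · P α α′ · g^per α′` for finitely supported `f g`); for a TWO-SCALE LEG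
  `ℓ γ β` (coarse site `γ`, fine site `β`) that is EQUIVARIANT (`ℓ (γ + Tc∘m) (β + Tf∘m) = ℓ γ β`) and finitely supported in `γ` (window `S β`):
  `tsum_leg_translate_fine_eq` (the two spellings `Σ'_m ℓ α (β + Tf∘m) = Σ'_m ℓ (α + Tc∘m) β` of the periodised leg), `sum_leg_window_translate`
  (re-indexing a window sum along a simultaneous translation), `tsum_diag_sandwich` (the DIAGONAL periodisation of a sandwich = the sandwich of the
  diagonally periodised core), `tsum_right_sandwich` (the second-leg periodisation of a sandwich = the sandwich of the right-periodised core).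
* §2 THE KERNEL STATEMENT (fibres `A` on the coarse side, `B` on the fine side; legs `CL γ a β b`, core `𝒢 : MKer (d+1) A`, the sandwich `𝒦 : MKer (d+1) B`
  and the periodised leg `C` DISPLAYED by their defining equations `h𝒦 ∕ hC` — no `def`):
  **`perZ_dper_sandwich`**: `perZ Tf (dper Tf 𝒦) β β′ b b′ = Σ_{α α′ ∈ pbox Tc} Σ_{a a′} C α a β b · perZ Tc (dper Tc 𝒢) α α′ a a′ · C α′ a′ β′ b′`
  under the two summability letters of the core (`hGd`: its diagonal `Tc`-translates, `hGp`: the `Tc`-translates of `dper Tc 𝒢` — exactly what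
  `KernelPeriodisationFibLoc.summable_dper ∕ decays_dper` supply for a bi-localised core).
* §3 THE MATRIX STATEMENT: **`transpose_mul_perF_dper_mul`**: `Cmᵀ * perF Tc (dper Tc 𝒢) * Cm = perF Tf (dper Tf 𝒦)` for the matrix `Cm` of `C`
  (`Matrix (Idx Tc A) (Idx Tf B) ℝ`) — the shape of ONE storey of `compSumSym` (`(compRowsSym …)ᵀ * G (towerTorus …) * compRowsSym …`) against ONE storey
  term of the N-binding's periodised kernel; and `perF_dper_inl_inl` (the `|ff` block of a periodised `Fib`-kernel is the periodisation of its `ff` part,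
  `rfl` pointwise) so that the wrapper's `(perF T (dper T 𝒱)).submatrix (·, inl ·) (·, inl ·)` spelling is served.
WHAT THIS IS NOT: not the instantiation (`compRowsSym` = the periodised composite lattice leg via leaf-02's `sum_compRowsSym_mul_periodic_of_clauses`; the
storey core = the Λ-brick contracted with an2's pulled-back multiplier `liftUpᵀ λ_top`; the storey sum against `compSumSym_succ ∕ onTowerFamily_towerTorus`);
not a discharge of `hHN₁` or of any displayed row; no estimate; nothing of Bałaban's asserted, valued or discharged; 0∕4 row-D1 binders (hW, hR, D1Tel, D1Rep);
NOT (C1), NOT (L2′), NOT (T-ID), NOT SDF, NOT D1, NOT BetaPertH, NOT continuum, NOT Clay.  No `def`, no `def … : Prop`, nothing cited, 0 sorry.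

HONEST DEPENDENCY (page 1, mandatory): continuum YM on T⁴ ⇐ BetaPertH ∧ nine spine estimates (0/9 proved); BetaPertH ⇐ (D1) ∧ (D4) ∧ CAP+tail;
G-an2-4 gates asym, D1 and NE2/3/4.  HONEST FRAMING (cell contract, verbatim): «discharging `BetaPertH` makes Bałaban's UV stability UNCONDITIONAL —
a real constructive-QFT result; it is NOT the continuum limit and NOT the Clay problem.»  ABSOLUTE RULE (cell charter, verbatim): «No internally-minted
statement may enter as a cited fact. Every hypothesis is either kernel-proved in this package or a verbatim quotation of a PUBLISHED theorem with page
reference. The manuscript(s) under audit are NOT citable for their own disputed steps — they are the thing under adjudication; programme-internal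
(2001/route/tribunal) claims are never citable.»  Road «FP» OWNER, b2b-balaban-beta-d1-p3 gen 36, 2026-08-25.  No existing file touched.
-/

noncomputable section

open scoped BigOperators

namespace Summit.QuantumFields.BalabanUV.Beta.FP.TorusTwoScaleSandwichPeriodic

open Finset Matrix
open Literature.MathematicalPhysics.QuantumFieldTheory.Balaban1983to89
open Literature.MathematicalPhysics.QuantumFieldTheory.Balaban1983to89.Beta
open B4TorusKernel.MultiPeriod (translate translate_apply)
open B4Reflection242 (translate_translate)
open B6Lemma24Torus (pbox)
open ExpKernelCalculus (MKer)
open Summit.QuantumFields.BalabanUV.Beta.FP.KernelPeriodisationFib (Idx perF perF_apply perZ perZ_apply perZ_translate_right perZ_translate_left)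
open Summit.QuantumFields.BalabanUV.Beta.FP.KernelPeriodisationFibLoc (dper dper_apply dper_translate)
open Summit.QuantumFields.BalabanUV.Beta.FP.KernelPeriodisationFibTrace (tsum_sites_eq_sum_tsum)

variable {d : ℕ}

/-! ## §1 Scalar engines on `ℤ^{d+1}` -/

section Scalar

/-- [folklore] translating by `m` and then by `−m` along the same period vector is the identity. -/
theorem translate_translate_neg (T : Fin (d + 1) → ℕ) (x m : Fin (d + 1) → ℤ) : translate T (translate T x m) (-m) = x := by
  rw [translate_translate, add_neg_cancel]; funext i; simp only [translate_apply, Pi.zero_apply, mul_zero, add_zero]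

/-- [folklore] for a fixed multi-index `m`, `x ↦ x + T∘m` is the right-addition equivalence by the vector `T∘m`. -/
theorem translate_eq_addRight (T : Fin (d + 1) → ℕ) (m x : Fin (d + 1) → ℤ) :
    translate T x m = Equiv.addRight (fun i => (T i : ℤ) * m i) x := by
  funext i; simp only [translate_apply, Equiv.coe_addRight, Pi.add_apply]

/-- [folklore] re-indexing a full lattice sum along the translation `x ↦ x + T∘m` (no convergence needed). -/
theorem tsum_translate_eq (T : Fin (d + 1) → ℕ) (m : Fin (d + 1) → ℤ) (G : (Fin (d + 1) → ℤ) → ℝ) :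
    ∑' x, G (translate T x m) = ∑' x, G x := by
  simp_rw [translate_eq_addRight T m]
  exact (Equiv.addRight (fun i => (T i : ℤ) * m i)).tsum_eq G

variable (Tc : Fin (d + 1) → ℕ)

/-- [folklore] **LATTICE = BOX × PERIOD LATTICE, IN BOTH VARIABLES, AGAINST A BI-PERIODIC PAIRING**: for `P` invariant under `Tc`-translation of
either argument and finitely supported `f`, `g` (windows `Sf ⊇ supp f`, `Sg ⊇ supp g`),
`Σ_{γ ∈ Sf} Σ_{γ′ ∈ Sg} f γ · P γ γ′ · g γ′ = Σ_{α, α′ ∈ pbox Tc} (Σ'_m f (α + Tc∘m)) · P α α′ · (Σ'_m g (α′ + Tc∘m))`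
(`KernelPeriodisationFibTrace.tsum_sites_eq_sum_tsum` once per variable; every `tsum` is finitely supported). -/
theorem sum_mul_biperiodic_mul_eq_box [∀ μ, NeZero (Tc μ)] (P : (Fin (d + 1) → ℤ) → (Fin (d + 1) → ℤ) → ℝ)
    (hP₁ : ∀ x y m, P (translate Tc x m) y = P x y) (hP₂ : ∀ x y m, P x (translate Tc y m) = P x y)
    (f g : (Fin (d + 1) → ℤ) → ℝ) (Sf Sg : Finset (Fin (d + 1) → ℤ)) (hf : ∀ x ∉ Sf, f x = 0) (hg : ∀ x ∉ Sg, g x = 0) :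
    ∑ γ ∈ Sf, ∑ γ' ∈ Sg, f γ * P γ γ' * g γ'
      = ∑ α : ↥(pbox Tc), ∑ α' : ↥(pbox Tc),
          (∑' m, f (translate Tc (α : Fin (d + 1) → ℤ) m)) * P α α' * (∑' m, g (translate Tc (α' : Fin (d + 1) → ℤ) m)) := by
  -- the second variable, at any first argument
  have inner : ∀ x, ∑ γ' ∈ Sg, P x γ' * g γ'
      = ∑ α' : ↥(pbox Tc), P x α' * ∑' m, g (translate Tc (α' : Fin (d + 1) → ℤ) m) := by
    intro x
    have hG : ∀ γ' ∉ Sg, P x γ' * g γ' = 0 := fun γ' h => by rw [hg γ' h, mul_zero]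
    have e1 : ∑' γ', P x γ' * g γ' = ∑ γ' ∈ Sg, P x γ' * g γ' := tsum_eq_sum hG
    rw [← e1, tsum_sites_eq_sum_tsum Tc (summable_of_ne_finset_zero hG)]
    refine Finset.sum_congr rfl fun α' _ => ?_
    rw [← tsum_mul_left]
    exact tsum_congr fun m => by rw [hP₂]
  -- the first variable
  have hF : ∀ γ ∉ Sf, f γ * ∑ γ' ∈ Sg, P γ γ' * g γ' = 0 := fun γ h => by rw [hf γ h, zero_mul]
  calc ∑ γ ∈ Sf, ∑ γ' ∈ Sg, f γ * P γ γ' * g γ'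
      = ∑ γ ∈ Sf, f γ * ∑ γ' ∈ Sg, P γ γ' * g γ' := by
        refine Finset.sum_congr rfl fun γ _ => ?_
        rw [Finset.mul_sum]
        exact Finset.sum_congr rfl fun _ _ => by ring
    _ = ∑' γ, f γ * ∑ γ' ∈ Sg, P γ γ' * g γ' := (tsum_eq_sum hF).symm
    _ = ∑ α : ↥(pbox Tc), ∑' m, f (translate Tc (α : Fin (d + 1) → ℤ) m) * ∑ γ' ∈ Sg, P (translate Tc (α : Fin (d + 1) → ℤ) m) γ' * g γ' :=
        tsum_sites_eq_sum_tsum Tc (summable_of_ne_finset_zero hF)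
    _ = ∑ α : ↥(pbox Tc), (∑' m, f (translate Tc (α : Fin (d + 1) → ℤ) m)) * ∑ γ' ∈ Sg, P α γ' * g γ' := by
        refine Finset.sum_congr rfl fun α _ => ?_
        rw [← tsum_mul_right]
        exact tsum_congr fun m => by simp_rw [hP₁]
    _ = _ := by
        refine Finset.sum_congr rfl fun α _ => ?_
        rw [inner, Finset.mul_sum]
        exact Finset.sum_congr rfl fun _ _ => by ring

variable (Tf : Fin (d + 1) → ℕ)

/-- [folklore] **THE TWO SPELLINGS OF THE PERIODISED TWO-SCALE LEG**: for a leg `ℓ γ β` EQUIVARIANT under simultaneous translation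
(`ℓ (γ + Tc∘m) (β + Tf∘m) = ℓ γ β`), periodising the fine argument or the coarse one is the same: `Σ'_m ℓ α (β + Tf∘m) = Σ'_m ℓ (α + Tc∘m) β`
(re-index `m ↦ −m`; no convergence needed). -/
theorem tsum_leg_translate_fine_eq (ℓ : (Fin (d + 1) → ℤ) → (Fin (d + 1) → ℤ) → ℝ)
    (hℓ : ∀ m γ β, ℓ (translate Tc γ m) (translate Tf β m) = ℓ γ β) (α β : Fin (d + 1) → ℤ) :
    ∑' m, ℓ α (translate Tf β m) = ∑' m, ℓ (translate Tc α m) β := by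
  have h : ∀ m, ℓ α (translate Tf β m) = ℓ (translate Tc α (-m)) β := fun m => by
    rw [← hℓ (-m) α (translate Tf β m), translate_translate_neg]
  simp_rw [h]
  exact (Equiv.neg (Fin (d + 1) → ℤ)).tsum_eq fun m => ℓ (translate Tc α m) β

/-- [folklore] **RE-INDEXING A WINDOW SUM ALONG A SIMULTANEOUS TRANSLATION**: for an equivariant leg with windows `S β ⊇ {γ | ℓ γ β ≠ 0}`,
`Σ_{γ ∈ S (β + Tf∘m)} ℓ γ (β + Tf∘m) · X γ = Σ_{γ ∈ S β} ℓ γ β · X (γ + Tc∘m)` for ANY `X` (both sums are the finitely supported `Σ'_γ`, re-indexed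
by `γ ↦ γ + Tc∘m`; only the window CONDITION is used, never an equality of windows). -/
theorem sum_leg_window_translate (ℓ : (Fin (d + 1) → ℤ) → (Fin (d + 1) → ℤ) → ℝ)
    (hℓ : ∀ m γ β, ℓ (translate Tc γ m) (translate Tf β m) = ℓ γ β)
    (S : (Fin (d + 1) → ℤ) → Finset (Fin (d + 1) → ℤ)) (hS : ∀ γ β, γ ∉ S β → ℓ γ β = 0)
    (m β : Fin (d + 1) → ℤ) (X : (Fin (d + 1) → ℤ) → ℝ) :
    ∑ γ ∈ S (translate Tf β m), ℓ γ (translate Tf β m) * X γ = ∑ γ ∈ S β, ℓ γ β * X (translate Tc γ m) := by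
  have h1 : ∀ γ ∉ S (translate Tf β m), ℓ γ (translate Tf β m) * X γ = 0 := fun γ h => by rw [hS γ _ h, zero_mul]
  have h2 : ∀ γ ∉ S β, ℓ γ β * X (translate Tc γ m) = 0 := fun γ h => by rw [hS γ _ h, zero_mul]
  have e1 : ∑' γ, ℓ γ (translate Tf β m) * X γ = ∑ γ ∈ S (translate Tf β m), ℓ γ (translate Tf β m) * X γ := tsum_eq_sum h1
  have e2 : ∑' γ, ℓ γ β * X (translate Tc γ m) = ∑ γ ∈ S β, ℓ γ β * X (translate Tc γ m) := tsum_eq_sum h2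
  rw [← e1, ← e2, ← tsum_translate_eq Tc m (fun γ => ℓ γ (translate Tf β m) * X γ)]
  exact tsum_congr fun γ => by rw [hℓ]

/-- [folklore] **RE-INDEXING BOTH WINDOWS OF A SANDWICH ALONG A SIMULTANEOUS TRANSLATION** (the diagonal case): for equivariant,
window-supported legs `ℓ`, `ℓ′` and ANY core `𝒢`,
`Σ_{γ ∈ S (β+Tf∘m)} Σ_{γ′ ∈ S′ (β′+Tf∘m)} ℓ γ (β+Tf∘m) · 𝒢 γ γ′ · ℓ′ γ′ (β′+Tf∘m) = Σ_{γ ∈ S β} Σ_{γ′ ∈ S′ β′} ℓ γ β · 𝒢 (γ+Tc∘m) (γ′+Tc∘m) · ℓ′ γ′ β′`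
(`sum_leg_window_translate` in each leg). -/
theorem sum_window_sandwich_translate (ℓ ℓ' : (Fin (d + 1) → ℤ) → (Fin (d + 1) → ℤ) → ℝ)
    (hℓ : ∀ m γ β, ℓ (translate Tc γ m) (translate Tf β m) = ℓ γ β) (hℓ' : ∀ m γ β, ℓ' (translate Tc γ m) (translate Tf β m) = ℓ' γ β)
    (S S' : (Fin (d + 1) → ℤ) → Finset (Fin (d + 1) → ℤ)) (hS : ∀ γ β, γ ∉ S β → ℓ γ β = 0) (hS' : ∀ γ β, γ ∉ S' β → ℓ' γ β = 0)
    (𝒢 : (Fin (d + 1) → ℤ) → (Fin (d + 1) → ℤ) → ℝ) (m β β' : Fin (d + 1) → ℤ) :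
    ∑ γ ∈ S (translate Tf β m), ∑ γ' ∈ S' (translate Tf β' m), ℓ γ (translate Tf β m) * 𝒢 γ γ' * ℓ' γ' (translate Tf β' m)
      = ∑ γ ∈ S β, ∑ γ' ∈ S' β', ℓ γ β * 𝒢 (translate Tc γ m) (translate Tc γ' m) * ℓ' γ' β' := by
  calc ∑ γ ∈ S (translate Tf β m), ∑ γ' ∈ S' (translate Tf β' m), ℓ γ (translate Tf β m) * 𝒢 γ γ' * ℓ' γ' (translate Tf β' m)
      = ∑ γ ∈ S (translate Tf β m), ℓ γ (translate Tf β m) *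
          ∑ γ' ∈ S' (translate Tf β' m), ℓ' γ' (translate Tf β' m) * 𝒢 γ γ' := by
        refine Finset.sum_congr rfl fun γ _ => ?_
        rw [Finset.mul_sum]
        exact Finset.sum_congr rfl fun _ _ => by ring
    _ = ∑ γ ∈ S β, ℓ γ β * ∑ γ' ∈ S' (translate Tf β' m), ℓ' γ' (translate Tf β' m) * 𝒢 (translate Tc γ m) γ' :=
        sum_leg_window_translate Tc Tf ℓ hℓ S hS m β _
    _ = ∑ γ ∈ S β, ℓ γ β * ∑ γ' ∈ S' β', ℓ' γ' β' * 𝒢 (translate Tc γ m) (translate Tc γ' m) := by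
        refine Finset.sum_congr rfl fun γ _ => ?_
        rw [sum_leg_window_translate Tc Tf ℓ' hℓ' S' hS' m β' _]
    _ = _ := by
        refine Finset.sum_congr rfl fun γ _ => ?_
        rw [Finset.mul_sum]
        exact Finset.sum_congr rfl fun _ _ => by ring

/-- [folklore] **RE-INDEXING THE SECOND WINDOW OF A SANDWICH** (the second-leg case): for an equivariant, window-supported second leg `ℓ′` and ANY
core `D`, `Σ_{γ ∈ S₁} Σ_{γ′ ∈ S′ (β′+Tf∘m)} u γ · D γ γ′ · ℓ′ γ′ (β′+Tf∘m) = Σ_{γ ∈ S₁} Σ_{γ′ ∈ S′ β′} u γ · D γ (γ′+Tc∘m) · ℓ′ γ′ β′`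
(the first leg `u` and its window are spectators). -/
theorem sum_window_right_translate (u : (Fin (d + 1) → ℤ) → ℝ) (S₁ : Finset (Fin (d + 1) → ℤ)) (ℓ' : (Fin (d + 1) → ℤ) → (Fin (d + 1) → ℤ) → ℝ)
    (hℓ' : ∀ m γ β, ℓ' (translate Tc γ m) (translate Tf β m) = ℓ' γ β)
    (S' : (Fin (d + 1) → ℤ) → Finset (Fin (d + 1) → ℤ)) (hS' : ∀ γ β, γ ∉ S' β → ℓ' γ β = 0)
    (D : (Fin (d + 1) → ℤ) → (Fin (d + 1) → ℤ) → ℝ) (m β' : Fin (d + 1) → ℤ) :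
    ∑ γ ∈ S₁, ∑ γ' ∈ S' (translate Tf β' m), u γ * D γ γ' * ℓ' γ' (translate Tf β' m)
      = ∑ γ ∈ S₁, ∑ γ' ∈ S' β', u γ * D γ (translate Tc γ' m) * ℓ' γ' β' := by
  refine Finset.sum_congr rfl fun γ _ => ?_
  calc ∑ γ' ∈ S' (translate Tf β' m), u γ * D γ γ' * ℓ' γ' (translate Tf β' m)
      = u γ * ∑ γ' ∈ S' (translate Tf β' m), ℓ' γ' (translate Tf β' m) * D γ γ' := by
        rw [Finset.mul_sum]
        exact Finset.sum_congr rfl fun _ _ => by ring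
    _ = u γ * ∑ γ' ∈ S' β', ℓ' γ' β' * D γ (translate Tc γ' m) := by
        rw [sum_leg_window_translate Tc Tf ℓ' hℓ' S' hS' m β' _]
    _ = _ := by
        rw [Finset.mul_sum]
        exact Finset.sum_congr rfl fun _ _ => by ring

omit Tc Tf in
/-- [folklore] **FINITE WINDOW SUMS PASS THROUGH A LATTICE SUM**: `Σ'_m Σ_{γ ∈ S₁} Σ_{γ′ ∈ S₂} u γ · X γ γ′ m · v γ′ = Σ_{γ ∈ S₁} Σ_{γ′ ∈ S₂} u γ · (Σ'_m X γ γ′ m) · v γ′`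
for a family `X` summable in `m` at every `(γ, γ′)` (`Summable.tsum_finsetSum` twice). -/
theorem tsum_window_sandwich_of_summable (S₁ S₂ : Finset (Fin (d + 1) → ℤ)) (u v : (Fin (d + 1) → ℤ) → ℝ)
    (X : (Fin (d + 1) → ℤ) → (Fin (d + 1) → ℤ) → (Fin (d + 1) → ℤ) → ℝ) (hX : ∀ γ γ', Summable (X γ γ')) :
    ∑' m : Fin (d + 1) → ℤ, ∑ γ ∈ S₁, ∑ γ' ∈ S₂, u γ * X γ γ' m * v γ'
      = ∑ γ ∈ S₁, ∑ γ' ∈ S₂, u γ * (∑' m : Fin (d + 1) → ℤ, X γ γ' m) * v γ' := by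
  have hsum : ∀ γ γ', Summable fun m : Fin (d + 1) → ℤ => u γ * X γ γ' m * v γ' :=
    fun γ γ' => ((hX γ γ').mul_left (u γ)).mul_right (v γ')
  rw [Summable.tsum_finsetSum fun γ _ => summable_sum fun γ' _ => hsum γ γ']
  refine Finset.sum_congr rfl fun γ _ => ?_
  rw [Summable.tsum_finsetSum fun γ' _ => hsum γ γ']
  refine Finset.sum_congr rfl fun γ' _ => ?_
  rw [tsum_mul_right, tsum_mul_left]

/-- [folklore] **THE DIAGONAL PERIODISATION OF A SANDWICH IS THE SANDWICH OF THE DIAGONALLY PERIODISED CORE**: for equivariant, window-supported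
legs `ℓ`, `ℓ′` and a core `𝒢` whose diagonal `Tc`-translates are summable pointwise,
`Σ'_{m₀} Σ_{γ ∈ S (β+Tf∘m₀)} Σ_{γ′ ∈ S′ (β′+Tf∘m₀)} ℓ γ (β+Tf∘m₀) · 𝒢 γ γ′ · ℓ′ γ′ (β′+Tf∘m₀)
   = Σ_{γ ∈ S β} Σ_{γ′ ∈ S′ β′} ℓ γ β · (Σ'_{m₀} 𝒢 (γ+Tc∘m₀) (γ′+Tc∘m₀)) · ℓ′ γ′ β′`. -/
theorem tsum_diag_sandwich (ℓ ℓ' : (Fin (d + 1) → ℤ) → (Fin (d + 1) → ℤ) → ℝ)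
    (hℓ : ∀ m γ β, ℓ (translate Tc γ m) (translate Tf β m) = ℓ γ β) (hℓ' : ∀ m γ β, ℓ' (translate Tc γ m) (translate Tf β m) = ℓ' γ β)
    (S S' : (Fin (d + 1) → ℤ) → Finset (Fin (d + 1) → ℤ)) (hS : ∀ γ β, γ ∉ S β → ℓ γ β = 0) (hS' : ∀ γ β, γ ∉ S' β → ℓ' γ β = 0)
    (𝒢 : (Fin (d + 1) → ℤ) → (Fin (d + 1) → ℤ) → ℝ) (hGd : ∀ γ γ', Summable fun m₀ : Fin (d + 1) → ℤ => 𝒢 (translate Tc γ m₀) (translate Tc γ' m₀))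
    (β β' : Fin (d + 1) → ℤ) :
    ∑' m₀ : Fin (d + 1) → ℤ, ∑ γ ∈ S (translate Tf β m₀), ∑ γ' ∈ S' (translate Tf β' m₀),
        ℓ γ (translate Tf β m₀) * 𝒢 γ γ' * ℓ' γ' (translate Tf β' m₀)
      = ∑ γ ∈ S β, ∑ γ' ∈ S' β', ℓ γ β * (∑' m₀ : Fin (d + 1) → ℤ, 𝒢 (translate Tc γ m₀) (translate Tc γ' m₀)) * ℓ' γ' β' := by
  simp_rw [sum_window_sandwich_translate Tc Tf ℓ ℓ' hℓ hℓ' S S' hS hS' 𝒢 _ β β']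
  exact tsum_window_sandwich_of_summable (S β) (S' β') (fun γ => ℓ γ β) (fun γ' => ℓ' γ' β')
    (fun γ γ' m₀ => 𝒢 (translate Tc γ m₀) (translate Tc γ' m₀)) hGd

/-- [folklore] **THE SECOND-LEG PERIODISATION OF A SANDWICH IS THE SANDWICH OF THE RIGHT-PERIODISED CORE**: for an equivariant, window-supported
second leg `ℓ′` and a core `D` whose second-argument `Tc`-translates are summable pointwise,
`Σ'_m Σ_{γ ∈ S₁} Σ_{γ′ ∈ S′ (β′+Tf∘m)} u γ · D γ γ′ · ℓ′ γ′ (β′+Tf∘m) = Σ_{γ ∈ S₁} Σ_{γ′ ∈ S′ β′} u γ · (Σ'_m D γ (γ′+Tc∘m)) · ℓ′ γ′ β′`. -/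
theorem tsum_right_sandwich (u : (Fin (d + 1) → ℤ) → ℝ) (S₁ : Finset (Fin (d + 1) → ℤ)) (ℓ' : (Fin (d + 1) → ℤ) → (Fin (d + 1) → ℤ) → ℝ)
    (hℓ' : ∀ m γ β, ℓ' (translate Tc γ m) (translate Tf β m) = ℓ' γ β)
    (S' : (Fin (d + 1) → ℤ) → Finset (Fin (d + 1) → ℤ)) (hS' : ∀ γ β, γ ∉ S' β → ℓ' γ β = 0)
    (D : (Fin (d + 1) → ℤ) → (Fin (d + 1) → ℤ) → ℝ) (hDp : ∀ γ γ', Summable fun m : Fin (d + 1) → ℤ => D γ (translate Tc γ' m))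
    (β' : Fin (d + 1) → ℤ) :
    ∑' m : Fin (d + 1) → ℤ, ∑ γ ∈ S₁, ∑ γ' ∈ S' (translate Tf β' m), u γ * D γ γ' * ℓ' γ' (translate Tf β' m)
      = ∑ γ ∈ S₁, ∑ γ' ∈ S' β', u γ * (∑' m : Fin (d + 1) → ℤ, D γ (translate Tc γ' m)) * ℓ' γ' β' := by
  simp_rw [sum_window_right_translate Tc Tf u S₁ ℓ' hℓ' S' hS' D _ β']
  exact tsum_window_sandwich_of_summable S₁ (S' β') u (fun γ' => ℓ' γ' β') (fun γ γ' m => D γ (translate Tc γ' m)) hDp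

end Scalar


/-! ## §2 The kernel statement: periodising a two-scale sandwich -/

section Kernel

variable (Tc Tf : Fin (d + 1) → ℕ) [∀ μ, NeZero (Tc μ)]
variable {A B : Type*} [Fintype A]

/-- [folklore] **`perZ_dper_sandwich` — THE PACKING ENGINE**.  Data: a two-scale leg `CL γ a β b` (coarse bond `(γ, a)`, fine bond `(β, b)`) EQUIVARIANT under
simultaneous translation by the two period vectors (`hCL`) and supported in the coarse site inside a window `S β` of the fine site (`hS`); a core
`𝒢 : MKer (d+1) A` on the coarse bonds whose diagonal `Tc`-translates (`hGd`) and whose diagonal periodisation's second-argument `Tc`-translates (`hGp`) are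
summable pointwise; the SANDWICH kernel `𝒦` on the fine bonds and the PERIODISED LEG `C`, DISPLAYED by their equations (`h𝒦`, `hC`).  Conclusion:
`perZ Tf (dper Tf 𝒦) β β′ b b′ = Σ_{a a′} Σ_{α α′ ∈ pbox Tc} C α a β b · perZ Tc (dper Tc 𝒢) α α′ a a′ · C α′ a′ β′ b′` — the fine-torus periodisation of
the lattice sandwich is the coarse-torus-box sandwich of the periodised core by the periodised legs.  (§1: `tsum_diag_sandwich`, then `tsum_right_sandwich`,
then `sum_mul_biperiodic_mul_eq_box` at the bi-periodic `perZ Tc (dper Tc 𝒢)`, then `tsum_leg_translate_fine_eq`; fibre pair by fibre pair.) -/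
theorem perZ_dper_sandwich (CL : (Fin (d + 1) → ℤ) → A → (Fin (d + 1) → ℤ) → B → ℝ)
    (hCL : ∀ m γ a β b, CL (translate Tc γ m) a (translate Tf β m) b = CL γ a β b)
    (S : (Fin (d + 1) → ℤ) → Finset (Fin (d + 1) → ℤ)) (hS : ∀ γ a β b, γ ∉ S β → CL γ a β b = 0)
    (𝒢 : MKer (d + 1) A)
    (hGd : ∀ γ γ' a a', Summable fun m₀ : Fin (d + 1) → ℤ => 𝒢 (translate Tc γ m₀) (translate Tc γ' m₀) a a')
    (hGp : ∀ γ γ' a a', Summable fun m : Fin (d + 1) → ℤ => dper Tc 𝒢 γ (translate Tc γ' m) a a')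
    {𝒦 : MKer (d + 1) B}
    (h𝒦 : ∀ β β' b b', 𝒦 β β' b b' = ∑ a, ∑ a', ∑ γ ∈ S β, ∑ γ' ∈ S β', CL γ a β b * 𝒢 γ γ' a a' * CL γ' a' β' b')
    {C : (Fin (d + 1) → ℤ) → A → (Fin (d + 1) → ℤ) → B → ℝ} (hC : ∀ α a β b, C α a β b = ∑' m : Fin (d + 1) → ℤ, CL α a (translate Tf β m) b)
    (β β' : Fin (d + 1) → ℤ) (b b' : B) :
    perZ Tf (dper Tf 𝒦) β β' b b'
      = ∑ a, ∑ a', ∑ α : ↥(pbox Tc), ∑ α' : ↥(pbox Tc),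
          C α a β b * perZ Tc (dper Tc 𝒢) α α' a a' * C α' a' β' b' := by
  -- the scalar data of a fibre pair
  have hCL' : ∀ (a : A) (b : B) (m γ β : Fin (d + 1) → ℤ), CL (translate Tc γ m) a (translate Tf β m) b = CL γ a β b :=
    fun a b m γ β => hCL m γ a β b
  have hS' : ∀ (a : A) (b : B) (γ β : Fin (d + 1) → ℤ), γ ∉ S β → CL γ a β b = 0 := fun a b γ β h => hS γ a β b h
  -- STEP 1: the diagonal periodisation of the sandwich is the sandwich of `dper Tc 𝒢`
  have step1 : ∀ β₁ β₁' : Fin (d + 1) → ℤ, dper Tf 𝒦 β₁ β₁' b b'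
      = ∑ a, ∑ a', ∑ γ ∈ S β₁, ∑ γ' ∈ S β₁', CL γ a β₁ b * dper Tc 𝒢 γ γ' a a' * CL γ' a' β₁' b' := by
    intro β₁ β₁'
    rw [dper_apply]
    simp_rw [h𝒦]
    have hre : ∀ m₀ : Fin (d + 1) → ℤ,
        (∑ a, ∑ a', ∑ γ ∈ S (translate Tf β₁ m₀), ∑ γ' ∈ S (translate Tf β₁' m₀),
            CL γ a (translate Tf β₁ m₀) b * 𝒢 γ γ' a a' * CL γ' a' (translate Tf β₁' m₀) b')
          = ∑ a, ∑ a', ∑ γ ∈ S β₁, ∑ γ' ∈ S β₁',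
              CL γ a β₁ b * 𝒢 (translate Tc γ m₀) (translate Tc γ' m₀) a a' * CL γ' a' β₁' b' :=
      fun m₀ => Finset.sum_congr rfl fun a _ => Finset.sum_congr rfl fun a' _ =>
        sum_window_sandwich_translate Tc Tf (fun γ β => CL γ a β b) (fun γ β => CL γ a' β b') (hCL' a b) (hCL' a' b') S S
          (hS' a b) (hS' a' b') (fun γ γ' => 𝒢 γ γ' a a') m₀ β₁ β₁'
    rw [tsum_congr hre]
    have hsum : ∀ a a', Summable fun m₀ : Fin (d + 1) → ℤ => ∑ γ ∈ S β₁, ∑ γ' ∈ S β₁',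
        CL γ a β₁ b * 𝒢 (translate Tc γ m₀) (translate Tc γ' m₀) a a' * CL γ' a' β₁' b' :=
      fun a a' => summable_sum fun γ _ => summable_sum fun γ' _ => ((hGd γ γ' a a').mul_left _).mul_right _
    rw [Summable.tsum_finsetSum fun a _ => summable_sum fun a' _ => hsum a a']
    refine Finset.sum_congr rfl fun a _ => ?_
    rw [Summable.tsum_finsetSum fun a' _ => hsum a a']
    refine Finset.sum_congr rfl fun a' _ => ?_
    rw [tsum_window_sandwich_of_summable (S β₁) (S β₁') (fun γ => CL γ a β₁ b) (fun γ' => CL γ' a' β₁' b')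
      (fun γ γ' m₀ => 𝒢 (translate Tc γ m₀) (translate Tc γ' m₀) a a') (fun γ γ' => hGd γ γ' a a')]
    rfl
  -- STEP 2: the second-argument periodisation of that is the sandwich of `perZ Tc (dper Tc 𝒢)`
  have step2 : perZ Tf (dper Tf 𝒦) β β' b b'
      = ∑ a, ∑ a', ∑ γ ∈ S β, ∑ γ' ∈ S β', CL γ a β b * perZ Tc (dper Tc 𝒢) γ γ' a a' * CL γ' a' β' b' := by
    rw [perZ_apply]
    simp_rw [step1]
    have hre : ∀ m : Fin (d + 1) → ℤ,
        (∑ a, ∑ a', ∑ γ ∈ S β, ∑ γ' ∈ S (translate Tf β' m), CL γ a β b * dper Tc 𝒢 γ γ' a a' * CL γ' a' (translate Tf β' m) b')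
          = ∑ a, ∑ a', ∑ γ ∈ S β, ∑ γ' ∈ S β', CL γ a β b * dper Tc 𝒢 γ (translate Tc γ' m) a a' * CL γ' a' β' b' :=
      fun m => Finset.sum_congr rfl fun a _ => Finset.sum_congr rfl fun a' _ =>
        sum_window_right_translate Tc Tf (fun γ => CL γ a β b) (S β) (fun γ β => CL γ a' β b') (hCL' a' b') S (hS' a' b')
          (fun γ γ' => dper Tc 𝒢 γ γ' a a') m β'
    rw [tsum_congr hre]
    have hsum : ∀ a a', Summable fun m : Fin (d + 1) → ℤ => ∑ γ ∈ S β, ∑ γ' ∈ S β',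
        CL γ a β b * dper Tc 𝒢 γ (translate Tc γ' m) a a' * CL γ' a' β' b' :=
      fun a a' => summable_sum fun γ _ => summable_sum fun γ' _ => ((hGp γ γ' a a').mul_left _).mul_right _
    rw [Summable.tsum_finsetSum fun a _ => summable_sum fun a' _ => hsum a a']
    refine Finset.sum_congr rfl fun a _ => ?_
    rw [Summable.tsum_finsetSum fun a' _ => hsum a a']
    refine Finset.sum_congr rfl fun a' _ => ?_
    rw [tsum_window_sandwich_of_summable (S β) (S β') (fun γ => CL γ a β b) (fun γ' => CL γ' a' β' b')
      (fun γ γ' m => dper Tc 𝒢 γ (translate Tc γ' m) a a') (fun γ γ' => hGp γ γ' a a')]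
    rfl
  -- STEP 3: lattice = box × period lattice against the bi-periodic `perZ Tc (dper Tc 𝒢)`, and the two spellings of the periodised leg
  rw [step2]
  refine Finset.sum_congr rfl fun a _ => Finset.sum_congr rfl fun a' _ => ?_
  have hP₁ : ∀ x y m, perZ Tc (dper Tc 𝒢) (translate Tc x m) y a a' = perZ Tc (dper Tc 𝒢) x y a a' :=
    fun x y m => perZ_translate_left Tc (fun m x y a b => dper_translate Tc 𝒢 m x y a b) x y m a a'
  have hP₂ : ∀ x y m, perZ Tc (dper Tc 𝒢) x (translate Tc y m) a a' = perZ Tc (dper Tc 𝒢) x y a a' :=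
    fun x y m => perZ_translate_right Tc (dper Tc 𝒢) x y m a a'
  rw [sum_mul_biperiodic_mul_eq_box Tc (fun x y => perZ Tc (dper Tc 𝒢) x y a a') hP₁ hP₂ (fun γ => CL γ a β b) (fun γ' => CL γ' a' β' b')
    (S β) (S β') (fun γ h => hS' a b γ β h) (fun γ' h => hS' a' b' γ' β' h)]
  refine Finset.sum_congr rfl fun α _ => Finset.sum_congr rfl fun α' _ => ?_
  rw [hC, hC, tsum_leg_translate_fine_eq Tc Tf (fun γ β => CL γ a β b) (hCL' a b),
    tsum_leg_translate_fine_eq Tc Tf (fun γ β => CL γ a' β b') (hCL' a' b')]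

end Kernel

/-! ## §3 The matrix statement: one storey of a companion sum against one storey term of a periodised kernel -/

section MatrixForm

variable (Tc Tf : Fin (d + 1) → ℕ) [∀ μ, NeZero (Tc μ)]
variable {A B : Type*} [Fintype A]

omit [∀ μ, NeZero (Tc μ)] in
/-- [folklore] four nested `Fintype` sums, fibres outermost, are the double sum over the bond type `Idx Tc A = ↥(pbox Tc) × A` (book-keeping for §3). -/
theorem sum_fibres_sites_eq_sum_idx (T : A → A → ↥(pbox Tc) → ↥(pbox Tc) → ℝ) :
    ∑ a, ∑ a', ∑ α : ↥(pbox Tc), ∑ α' : ↥(pbox Tc), T a a' α α'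
      = ∑ p : Idx Tc A, ∑ p' : Idx Tc A, T p.2 p'.2 p.1 p'.1 := by
  have h1 : ∑ a, ∑ a', ∑ α : ↥(pbox Tc), ∑ α' : ↥(pbox Tc), T a a' α α'
      = ∑ a, ∑ α : ↥(pbox Tc), ∑ α' : ↥(pbox Tc), ∑ a', T a a' α α' :=
    Finset.sum_congr rfl fun a _ => by
      rw [Finset.sum_comm]
      exact Finset.sum_congr rfl fun α _ => Finset.sum_comm
  rw [h1, Finset.sum_comm, Fintype.sum_prod_type]
  refine Finset.sum_congr rfl fun α _ => Finset.sum_congr rfl fun a _ => ?_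
  rw [Fintype.sum_prod_type]

/-- [folklore] **`transpose_mul_perF_dper_mul` — THE PACKING ENGINE, MATRIX FORM**: with the data of `perZ_dper_sandwich` and the periodised leg AS A
MATRIX `Cm : Matrix (Idx Tc A) (Idx Tf B) ℝ` (`hCm`), `Cmᵀ * perF Tc (dper Tc 𝒢) * Cm = perF Tf (dper Tf 𝒦)` — ONE storey of leaf-06's companion sum
`(compRowsSym …)ᵀ * G (towerTorus …) * compRowsSym …` (companion := the periodised core on the storey torus, rows := the periodised composite leg)
IS the periodisation on the finest torus of ONE storey term of the lattice kernel. -/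
theorem transpose_mul_perF_dper_mul (CL : (Fin (d + 1) → ℤ) → A → (Fin (d + 1) → ℤ) → B → ℝ)
    (hCL : ∀ m γ a β b, CL (translate Tc γ m) a (translate Tf β m) b = CL γ a β b)
    (S : (Fin (d + 1) → ℤ) → Finset (Fin (d + 1) → ℤ)) (hS : ∀ γ a β b, γ ∉ S β → CL γ a β b = 0)
    (𝒢 : MKer (d + 1) A)
    (hGd : ∀ γ γ' a a', Summable fun m₀ : Fin (d + 1) → ℤ => 𝒢 (translate Tc γ m₀) (translate Tc γ' m₀) a a')
    (hGp : ∀ γ γ' a a', Summable fun m : Fin (d + 1) → ℤ => dper Tc 𝒢 γ (translate Tc γ' m) a a')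
    {𝒦 : MKer (d + 1) B}
    (h𝒦 : ∀ β β' b b', 𝒦 β β' b b' = ∑ a, ∑ a', ∑ γ ∈ S β, ∑ γ' ∈ S β', CL γ a β b * 𝒢 γ γ' a a' * CL γ' a' β' b')
    {C : (Fin (d + 1) → ℤ) → A → (Fin (d + 1) → ℤ) → B → ℝ} (hC : ∀ α a β b, C α a β b = ∑' m : Fin (d + 1) → ℤ, CL α a (translate Tf β m) b)
    {Cm : Matrix (Idx Tc A) (Idx Tf B) ℝ} (hCm : ∀ (p : Idx Tc A) (q : Idx Tf B), Cm p q = C p.1 p.2 q.1 q.2) :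
    Cmᵀ * perF Tc (dper Tc 𝒢) * Cm = perF Tf (dper Tf 𝒦) := by
  ext q q'
  rw [perF_apply, perZ_dper_sandwich Tc Tf CL hCL S hS 𝒢 hGd hGp h𝒦 hC, sum_fibres_sites_eq_sum_idx Tc, Matrix.mul_apply, Finset.sum_comm]
  refine Finset.sum_congr rfl fun p _ => ?_
  rw [Matrix.mul_apply, Finset.sum_mul]
  refine Finset.sum_congr rfl fun p' _ => ?_
  rw [Matrix.transpose_apply, hCm, hCm, perF_apply]

open OneStepResolventKernel (Fib)

omit [∀ μ, NeZero (Tc μ)] in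
/-- [folklore] **THE `ff` BLOCK OF A PERIODISED `Fib`-KERNEL IS THE PERIODISATION OF ITS `ff` PART** (pointwise `rfl`: `perF ∕ perZ ∕ dper` act on the
site arguments only) — so the wrapper's companions `(perF T (dper T 𝒱)).submatrix (·, inl ·) (·, inl ·)` are `perF T (dper T 𝒱^{ff})` with the fibre
`A := Fin (d+1)`, the shape §2–§3 consume. -/
theorem perF_dper_submatrix_inl (T : Fin (d + 1) → ℕ) (𝒱 : MKer (d + 1) (Fib d)) :
    (perF T (dper T 𝒱)).submatrix (fun b : ↥(pbox T) × Fin (d + 1) => ((b.1, Sum.inl b.2) : Idx T (Fib d)))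
        (fun b : ↥(pbox T) × Fin (d + 1) => ((b.1, Sum.inl b.2) : Idx T (Fib d)))
      = perF T (dper T (fun x y (a a' : Fin (d + 1)) => 𝒱 x y (Sum.inl a) (Sum.inl a'))) := by
  ext p q
  rfl

end MatrixForm

end Summit.QuantumFields.BalabanUV.Beta.FP.TorusTwoScaleSandwichPeriodic

end
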